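import Literature.MathematicalPhysics.QuantumFieldTheory.Balaban1983to89.B9Cor36GpDirAtMemberBlocks
import Literature.MathematicalPhysics.QuantumFieldTheory.Balaban1983to89.B9CubeSequence408MirrorsStencil

/-!
# `Balaban1983to89.B9Cor36GpDirAtMemberBlocksG` — [Balaban1985BackgroundPropagators] Cor. 3.6 p. 408 ON ROAD P4, HEAD-READY FORM: the four (3.42) block majorants
# of `η²G′_□(U)` on all the member's blocks for UNITARY-valued `U` and gauge `u` (the bi-contractivity displays discharged) with the collar geometry `hS2`
# discharged by `B9CubeSequence408MirrorsStencil.hS2_dirDomY` — the supplier of the heads' row `h36b` modulo the (3.35) datum of `Ω₀(□)` and the record's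
# thresholds ∕ numerics — sub-row G-B9-LETTERS (site sector), seat dag-n06-c g32 UNIT 12

statement-level skeleton of published theorems with citation tags; proofs where landed; nothing here is a claim about the Yang–Mills mass gap

CITATION HEADER (lean-in-tree rule).  B9 = T. Bałaban, *Propagators for lattice gauge theories in a background field*, Commun. Math. Phys. **99** (1985)
389–434 [Balaban1985BackgroundPropagators] (held `paper:balaban1985-cmp99-background-propagators`; journal page = PDF page + 388): Cor. 3.6 p. 408 l. 7–11
(«If a configuration U satisfies (3.35) with O(1)Mα₀ ≦ a₁, and Ω′₀ ⊂ □ for a cube □ of the class described in this condition, then Theorems 3.1–3.3 hold for the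
operators G′(U), (Q′(U)G′²(U)Q′*(U))⁻¹, G(U) constructed for the sequence {Ω′_j}. This follows from Corollary 3.5 applied to the configuration U′ = Uᵘ, and we have to
recall only that all the results of these theorems are gauge invariant.»); (3.35) p. 396 («U is a configuration with values in G» — unitary groups, p. 390);
Thm 3.1 (3.42) p. 397; p. 408 (the collars).  Rows B9.Cor3.6 × B9.Thm3.1(3.42) (cells only; no row head changes).

WHY THIS FILE.  `B9Cor36GpDirAtMemberBlocks.gpDir_at_member_blocks` (UNIT 10) displays the collar geometry `hS2` and the bi-contractivity of `u` and `Uᵘ`;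
UNIT 11 proves `hS2` (`hS2_dirDomY`) and UNIT 10 §3 derives the bi-contractivity from unitarity (`hR_of_unitary`, `hg_of_unitary`).  This file folds the three
in: the h36b supplier for unitary-valued `U`, `u` with ONLY the (3.35) datum of `Ω₀(□)` (LOCATED-32), p06's numerics and the thresholds displayed.

WHAT IS PROVED (0 `def`s; 0 sorry; 0 new named facts; standard axioms): ★★★`gpDir_at_member_blocks_unitary`.
-/

noncomputable section

namespace Literature.MathematicalPhysics.QuantumFieldTheory.Balaban1983to89.B9Cor36GpDirAtMemberBlocksG

open Literature.MathematicalPhysics.QuantumFieldTheory.Balaban1983to89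
open Literature.MathematicalPhysics.QuantumFieldTheory.Balaban1983to89.B6RandomWalk (HasMajorant)
open Literature.MathematicalPhysics.QuantumFieldTheory.Balaban1983to89.B9Thm34Ext (toB6)
open Literature.MathematicalPhysics.QuantumFieldTheory.Balaban1983to89.B9Eq352DivFormLetters (conj)
open Literature.MathematicalPhysics.QuantumFieldTheory.Balaban1983to89.B9Eq352GradLetters (diffLetter)
open Literature.MathematicalPhysics.QuantumFieldTheory.Balaban1983to89.B9Eq39Adjoint (R fluct covD)
open Literature.MathematicalPhysics.QuantumFieldTheory.Balaban1983to89.B6KLevelCensusIndexV1 (KIdx kGeo)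
open Literature.MathematicalPhysics.QuantumFieldTheory.Balaban1983to89.B6Cover236MultiLevelBlocks (cubes)
open Literature.MathematicalPhysics.QuantumFieldTheory.Balaban1983to89.B6GlobalChartV1 (PV boxEquiv)
open Literature.MathematicalPhysics.QuantumFieldTheory.Balaban1983to89.B6Geom246MultiLevelBox (blkOf)
open Literature.MathematicalPhysics.QuantumFieldTheory.Balaban1983to89.B9BackgroundsKLevelV1 (shiftsV1)
open Literature.MathematicalPhysics.QuantumFieldTheory.Balaban1983to89.B9Eq360DeltaPrimeAY (AfldY)
open Literature.MathematicalPhysics.QuantumFieldTheory.Balaban1983to89.B9CubeLettersOpsL0 (levCubeY)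
open Literature.MathematicalPhysics.QuantumFieldTheory.Balaban1983to89.B9CubeGeometryInputs (RM1)
open Literature.MathematicalPhysics.QuantumFieldTheory.Balaban1983to89.B9Cor35GpDirInputsAtOne (dirDomY)
open Literature.MathematicalPhysics.QuantumFieldTheory.Balaban1983to89.B9Cor36GpDirAtMemberBlocks (gpDir_at_member_blocks hR_of_unitary hg_of_unitary)
open Literature.MathematicalPhysics.QuantumFieldTheory.Balaban1983to89.B9CubeSequence408MirrorsStencil (hS2_dirDomY)
open Literature.MathematicalPhysics.QuantumFieldTheory.Balaban1983to89.B9SectBAllBlocksGeometryY (geoBK)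
open Literature.MathematicalPhysics.QuantumFieldTheory.Balaban1983to89.B7Prop2Explicit (C0 c2' unitaryUnits)
open Literature.MathematicalPhysics.QuantumFieldTheory.Balaban1983to89.B7Prop3Flat (c3)
open Literature.MathematicalPhysics.QuantumFieldTheory.Balaban1983to89.Node00 (SiteY CfgY GaugeY toKT shiftY gaugeY UboxY lapSL)
open Literature.MathematicalPhysics.QuantumFieldTheory.Balaban1983to89.Node00.OpsYCubeDirInverse (padDeltaCubeY GpDirY)
open Literature.MathematicalPhysics.QuantumFieldTheory.Balaban1983to89.Node00.OpsYCubeKnitPar (parKnitCubeY)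
open scoped Matrix

variable {d ℓ : ℕ} {hd : 1 ≤ d + 1} {hL : Odd (ℓ + 1) ∧ 1 < ℓ + 1} {b₀ b₁ : ℝ}

section Main

open scoped Matrix.Norms.L2Operator

variable {N : ℕ} [Nonempty (Fin N)]
variable {ι : Type} [Fintype ι] [DecidableEq ι] (b : Module.Basis ι ℝ (Matrix (Fin N) (Fin N) ℂ))

/-- ★★★ **COROLLARY 3.6 AT ONE COVER CUBE ON ROAD P4, HEAD-READY: THE FOUR (3.42) BLOCK MAJORANTS OF `η²G′_□(U)` ON ALL THE MEMBER's BLOCKS FOR UNITARY-VALUED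
`U` AND GAUGE `u`** — `B9Cor36GpDirAtMemberBlocks.gpDir_at_member_blocks` with the collar geometry (`hS2_dirDomY`) and the bi-contractivity (`hR_of_unitary`,
`hg_of_unitary`) discharged: displayed remain only the (3.35) datum `(u, A)` of `Ω₀(□)` on `Q ⊇ chart⁻¹Ω₀(□)` with its constants `C, ξ, Λ` (`2CΛ² ≤ min(a₁, ¼)`),
p06's window numerics `α₀′`, and the thresholds `M₀, N₀, T₀`.
[cite: Balaban1985BackgroundPropagators, Cor. 3.6 p.408 l.7–11, (3.35) p.396, Thm 3.1 (3.42) p.397, p.408 (collars), p.409 l.1–5; Balaban1984PropagatorsII, (2.51)–(2.55) p.232] -/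
theorem gpDir_at_member_blocks_unitary (d ℓ : ℕ) (hℓ : 1 ≤ ℓ) (M₂ : ℝ) (hM₂ : 0 ≤ M₂) (hrepr : ∀ (v : Matrix (Fin N) (Fin N) ℂ) (j : ι), |b.repr v j| ≤ M₂ * ‖v‖) :
    ∃ δ Bm M₀ T₀ : ℝ, ∃ N₀ : ℕ, 0 < δ ∧ 0 ≤ Bm ∧ ∃ a₁ : ℝ, 0 < a₁ ∧
    ∀ {hd : 1 ≤ d + 1} {hL : Odd (ℓ + 1) ∧ 1 < ℓ + 1} {b₀ b₁ : ℝ} (i : KIdx d ℓ hd hL b₀ b₁) (c : ↥(cubes (toKT i).D.toDomains)),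
      M₀ ≤ ((ℓ : ℝ) + 1) * (toKT i).Mh → N₀ + 1 ≤ (toKT i).R * ((ℓ + 1) * (toKT i).Mh) → T₀ ≤ RM1 i →
    ∀ (g : GaugeY (Matrix (Fin N) (Fin N) ℂ) i) (U : CfgY (Matrix (Fin N) (Fin N) ℂ) i) (A : AfldY (Matrix (Fin N) (Fin N) ℂ) i)
      (Q : Set (Site (PV d ℓ i.m i.K hd hL) 0)) (C ξ Λ α₀' : ℝ),
      (∀ x, g x ∈ unitaryUnits (Matrix (Fin N) (Fin N) ℂ)) → (∀ μ x, U μ x ∈ unitaryUnits (Matrix (Fin N) (Fin N) ℂ)) →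
      0 ≤ C → (kGeo i).eta ≤ ξ → 1 ≤ Λ → LatticeNorms.scaleLen ((ℓ : ℝ) + 1) (kGeo i).eta (c.1.1 + 1) ≤ Λ * ξ →
      (∀ z ∈ dirDomY i c, (boxEquiv i.hN).symm z ∈ Q) →
      (∀ (κ : Fin (d + 1)) (x : Site (PV d ℓ i.m i.K hd hL) 0), x ∈ Q → x.shift κ ∈ Q → gaugeY i g U κ x = fluct (kGeo i).eta A κ x) →
      (∀ κ, ∀ x ∈ Q, ‖A κ x‖ ≤ C * ξ⁻¹) →
      (∀ μ ν, ∀ x ∈ Q, ‖(((kGeo i).eta : ℂ)⁻¹) • covD (shiftsV1 (PV d ℓ i.m i.K hd hL)) (fun _ _ => (1 : (Matrix (Fin N) (Fin N) ℂ)ˣ)) μ (A ν) x‖ ≤ C * (ξ ^ 2)⁻¹) →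
      2 * C * Λ ^ 2 ≤ a₁ → 2 * C * Λ ^ 2 ≤ 1 / 4 →
      0 < α₀' → C0 (d + 1) * α₀' ≤ 1 / 3 → 4 * α₀' ≤ c2' (d + 1) (ℓ + 1) →
      Real.exp (4 * (800 * (((d + 1 : ℕ) : ℝ) + 1) ^ 2 * (((d + 1 : ℕ) : ℝ) + 4)) * α₀') * (1 + 8 * (131072 * (((d + 1 : ℕ) : ℝ) + 1) ^ 2) * (2 * C * Λ ^ 2)) ≤ 2 →
      2 * (2 * C * Λ ^ 2) ≤ c3 (d + 1) (ℓ + 1) → 4096 * ((d + 1 : ℕ) : ℝ) * (2 * C * Λ ^ 2) ≤ 1 →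
    ∀ [Fintype (geoBK i).Site] (Rr : ℝ) (Hp : Prop),
      IsUnit (padDeltaCubeY i c (parKnitCubeY i c) (dirDomY i c) (gaugeY i g U)) ∧
      HasMajorant (g := toB6 (geoBK i) Rr Hp) (fun p : SiteY i × ι => blkOf i.D.toDomains p.1)
        (conj b (((kGeo i).eta ^ 2) • (GpDirY i c (parKnitCubeY i c) (dirDomY i c) U).restrictScalars ℝ))
        (fun a a' => Bm * (geoBK i).len a ^ 2 * Real.exp (-(δ * (geoBK i).dist a a'))) ∧
      (∀ μ : Fin (d + 1), HasMajorant (g := toB6 (geoBK i) Rr Hp) (fun p : SiteY i × ι => blkOf i.D.toDomains p.1)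
        (conj b (diffLetter (shiftY i) (UboxY i U) ((((kGeo i).eta : ℂ))⁻¹) (Sum.inl μ)) *
          conj b (((kGeo i).eta ^ 2) • (GpDirY i c (parKnitCubeY i c) (dirDomY i c) U).restrictScalars ℝ))
        (fun a a' => Bm * (geoBK i).len a * Real.exp (-(δ * (geoBK i).dist a a')))) ∧
      (∀ μ : Fin (d + 1), HasMajorant (g := toB6 (geoBK i) Rr Hp) (fun p : SiteY i × ι => blkOf i.D.toDomains p.1)
        (conj b (((kGeo i).eta ^ 2) • (GpDirY i c (parKnitCubeY i c) (dirDomY i c) U).restrictScalars ℝ) *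
          conj b (diffLetter (shiftY i) (UboxY i U) ((((kGeo i).eta : ℂ))⁻¹) (Sum.inr μ)))
        (fun a a' => Bm * (geoBK i).len a * Real.exp (-(δ * (geoBK i).dist a a')))) ∧
      HasMajorant (g := toB6 (geoBK i) Rr Hp) (fun p : SiteY i × ι => blkOf i.D.toDomains p.1)
        (conj b ((((kGeo i).eta ^ 2)⁻¹ : ℝ) • (lapSL i U).restrictScalars ℝ) *
          conj b (((kGeo i).eta ^ 2) • (GpDirY i c (parKnitCubeY i c) (dirDomY i c) U).restrictScalars ℝ))
        (fun a a' => Bm * 1 * Real.exp (-(δ * (geoBK i).dist a a'))) := by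
  obtain ⟨δ, Bm, M₀, T₀, N₀, hδ, hBm, a₁, ha₁, H⟩ := gpDir_at_member_blocks b d ℓ hℓ M₂ hM₂ hrepr
  refine ⟨δ, Bm, M₀, T₀, N₀, hδ, hBm, a₁, ha₁, ?_⟩
  intro hd hL b₀ b₁ i c hM hN hT g U A Q C ξ Λ α₀' hu hU hC hξ hΛ hΛξ hQ hgA hA hdA hα₁ hα4 hα' hα3 hα4' hsmall hc₃ hsm _ Rr Hp
  exact H i c hM hN hT g U A Q C ξ Λ α₀' hC hξ hΛ hΛξ hQ hgA hA hdA (fun z hz => hS2_dirDomY i c z hz) hα₁ hα4 hα' hα3 hα4' hsmall hc₃ hsm (hR_of_unitary i hu hU)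
    (hg_of_unitary i hu) Rr Hp

end Main

end Literature.MathematicalPhysics.QuantumFieldTheory.Balaban1983to89.B9Cor36GpDirAtMemberBlocksG

end
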